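import Mathlib
import HarnessLib
import Summits.Ventures.LatticeQCDFlow.Scoring.DoeblinPowerTwoChainAgreementCoverage
import Summits.Ventures.LatticeQCDFlow.Scoring.RestartJarzynskiWeights
import Summits.Ventures.LatticeQCDFlow.Scoring.RestartTimeAverage

/-!
# THE TWO-PROTOCOL AGREEMENT TEST OF NE-MCMC: two independent correlated-restart Jarzynski runs of
# two protocols between the SAME pair of ensembles report the same number `Z₁/Z₀ = e^{−ΔF}`, so the
# z-statistic of their mean weights with the two batch-means error bars is asymptotically standard
# normal from EVERY pair of starts — and the test is calibrated

HONEST FRAMING: exact (Metropolis-corrected) sampling algorithms for lattice gauge theory;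
figures of merit are autocorrelation/cost numbers at stated couplings and volumes; no
continuum-physics claim.

Venture `LatticeQCDFlow` (cell pub-lqcd), topic `Scoring`; FANOUT row 8 (`s0-cpn-nemc` — S0-D2 is the
correlated-restart NE-MCMC protocol: each non-equilibrium evolution starts from the current state of
an equilibrium PRIOR chain and the Jarzynski weights `e^{−W}` are averaged; Bonanno–Nada–Vadacchino
2024 NAMED ONLY — GEN-25).  NEW WORK of the cell, not a published result; no definition is
introduced; nothing is cited as a fact.

THE SITUATION TYPED HERE is the cell's A-versus-B rule applied to the protocol itself: the same
free-energy difference is measured by TWO protocols — two Crooks pairs `(κF, κR, s, e, W)` on a path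
space `E` and `(κF', κR', s', e', W')` on a path space `E'` between the SAME finite measures
`ν₀ → ν₁` (e.g. two numbers of non-equilibrium steps, two interpolations of the defect / boundary
coupling, or two independent implementations), each driven by its own prior chain `κ₀`, `κ₀'` leaving
`π₀ = Z₀⁻¹ ν₀` invariant with one-step Doeblin constants `ε, ε' > 0`, each with a work floor.  The two
restart chains `K = prodMkRight E κ₀ ⊗ₖ prodMkLeft (Ω × E) κF` (invariant law `Π = π₀ ⊗ₘ κF`,
minorised in ONE step by `ε Π`: `Scoring/RestartTimeAverage.restart_doeblin`) are run INDEPENDENTLY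
from arbitrary initial laws `μ₀`, `μ₀'`, with `n` and `m_n → ∞` records and batch-means error bars
`σ̂²_A,n`, `σ̂²_B,m_n` (any `a, b, a', b' → ∞`).  WHATEVER the two protocols, both mean weights are
the same number: `∫ e^{−W} dΠ = Z₁/Z₀ = ∫ e^{−W'} dΠ'`
(`Scoring/RestartJarzynskiWeights.restart_jarzynski_mean`).  Hence GEN-22's two-chain agreement
theorem (`Scoring/DoeblinPowerTwoChainAgreement.lean`, row 4's abstract two-sample device fed with
row 13's Doeblin-power CLT) applies with NO hypothesis relating the two protocols:

* **`restart_jarzynski_twoProtocol_agreement_clt`** — for `Z ~ N(0, 1)` and positive asymptotic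
  variances of the two weight sequences (ASSUMED),
  `z_n = (Ḡ_A,n − Ḡ'_B,m_n) / √(σ̂²_A,n/n + σ̂²_B,m_n/m_n) ⇒ Z` under `P_{μ₀} ⊗ P'_{μ₀'}`;
* **`restart_jarzynski_twoProtocol_agreement_coverage`** — for every `z > 0`,
  `(P_{μ₀} ⊗ P'_{μ₀'}) {|z_n| ≤ z} → (gaussianReal 0 1)[−z, z]`: two exact NE-MCMC protocols for the
  same `ΔF` disagree by more than `1.96 σ_comb` in the mean weight with asymptotic frequency `0.05`,
  however different their strides, path spaces and prior chains, and however they were started.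

READING: this is the calibrated form of the «two implementations / two protocol lengths must agree
within error bars» check at the level of `e^{−ΔF}`; a persistent `|z_n| > z` flags a broken
exactness premise (a protocol that is not a Crooks pair between `ν₀` and `ν₁`, a prior chain that does
not leave `π₀` invariant), not a statistical fluctuation.

NOT CLAIMED: the `ΔF`-level version (difference of `−log Ḡ`'s with delta-method bars — a two-sample
delta method, not typed here); any value of the variances or of `ε, ε'` for a concrete protocol; the
degenerate case of a vanishing asymptotic variance; the power of the test against a given bias; any
number of ours.
-/

noncomputable section

namespace Summit.Ventures.LatticeQCDFlow.Scoring

open MeasureTheory ProbabilityTheory Filter Finset Preorder Set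
open Summit.Ventures.LatticeQCDFlow.Exactness Summit.Ventures.LatticeQCDFlow.Exactness.GeneralNCMC
open scoped ENNReal Topology

section TwoProtocols

variable {Ω E E' : Type*} [MeasurableSpace Ω] [MeasurableSpace E] [MeasurableSpace E']
  {ν₀ ν₁ : Measure Ω} [IsFiniteMeasure ν₀] [IsFiniteMeasure ν₁]
  {κF κR : Kernel Ω E} [IsMarkovKernel κF] [IsMarkovKernel κR] {s e : E → Ω} {W : E → ℝ}
  {κF' κR' : Kernel Ω E'} [IsMarkovKernel κF'] [IsMarkovKernel κR'] {s' e' : E' → Ω} {W' : E' → ℝ}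
  {κ₀ κ₀' : Kernel Ω Ω} [IsMarkovKernel κ₀] [IsMarkovKernel κ₀']
  {π₀ : Measure Ω} [IsProbabilityMeasure π₀] {ε ε' : ℝ≥0∞}

omit [IsFiniteMeasure ν₀] [IsFiniteMeasure ν₁] in
/-- **THE TWO-PROTOCOL AGREEMENT TEST OF NE-MCMC IS ASYMPTOTICALLY STANDARD NORMAL, FROM EVERY PAIR
OF STARTS.**  Two Crooks pairs between the same `ν₀ → ν₁`, two prior chains leaving
`π₀ = Z₀⁻¹ ν₀` invariant with one-step Doeblin constants `ε, ε' > 0`, work floors, positive asymptotic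
variances of the two weight sequences, `a, b, a', b' → ∞`, `m_n → ∞`; the two restart chains run
independently from arbitrary initial laws `μ₀`, `μ₀'`.  For `Z ~ N(0, 1)`:
`(Ḡ_A,n − Ḡ'_B,m_n) / √(σ̂²_A,n/n + σ̂²_B,m_n/m_n) ⇒ Z` under `P_{μ₀} ⊗ P'_{μ₀'}` — with no
hypothesis relating the two protocols, because both mean weights equal `Z₁/Z₀`. -/
theorem restart_jarzynski_twoProtocol_agreement_clt
    (h : CrooksPair ν₀ ν₁ κF κR s e W) (h' : CrooksPair ν₀ ν₁ κF' κR' s' e' W')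
    (hπ₀ : π₀ = (ν₀ univ)⁻¹ • ν₀)
    (hinv : Kernel.Invariant κ₀ π₀) (hinv' : Kernel.Invariant κ₀' π₀)
    (hmin : ∀ x {B : Set Ω}, MeasurableSet B → ε * π₀ B ≤ κ₀ x B) (hε0 : 0 < ε)
    (hmin' : ∀ x {B : Set Ω}, MeasurableSet B → ε' * π₀ B ≤ κ₀' x B) (hε0' : 0 < ε')
    {Wlo : ℝ} (hlo : ∀ ω, Wlo ≤ W ω) {Wlo' : ℝ} (hlo' : ∀ ω, Wlo' ≤ W' ω)
    (hσ : 0 < ((∫ p, (Real.exp (-W p.2) - ∫ p', Real.exp (-W p'.2) ∂(π₀ ⊗ₘ κF)) ^ 2 ∂(π₀ ⊗ₘ κF))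
          + 2 * ∑' k, ∫ p, (Real.exp (-W p.2) - ∫ p', Real.exp (-W p'.2) ∂(π₀ ⊗ₘ κF))
            * (kop ((Kernel.prodMkRight E κ₀) ⊗ₖ (Kernel.prodMkLeft (Ω × E) κF)))^[k + 1]
              (fun p => Real.exp (-W p.2) - ∫ p', Real.exp (-W p'.2) ∂(π₀ ⊗ₘ κF)) p ∂(π₀ ⊗ₘ κF)))
    (hσ' : 0 < ((∫ p, (Real.exp (-W' p.2) - ∫ p', Real.exp (-W' p'.2) ∂(π₀ ⊗ₘ κF')) ^ 2
            ∂(π₀ ⊗ₘ κF'))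
          + 2 * ∑' k, ∫ p, (Real.exp (-W' p.2) - ∫ p', Real.exp (-W' p'.2) ∂(π₀ ⊗ₘ κF'))
            * (kop ((Kernel.prodMkRight E' κ₀') ⊗ₖ (Kernel.prodMkLeft (Ω × E') κF')))^[k + 1]
              (fun p => Real.exp (-W' p.2) - ∫ p', Real.exp (-W' p'.2) ∂(π₀ ⊗ₘ κF')) p
              ∂(π₀ ⊗ₘ κF')))
    (μ₀ : Measure (Ω × E)) [IsProbabilityMeasure μ₀] {a b : ℕ → ℕ} (ha : Tendsto a atTop atTop)
    (hb : Tendsto b atTop atTop)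
    [IsProbabilityMeasure (Kernel.trajMeasure (X := fun _ : ℕ => Ω × E) μ₀
          (fun n : ℕ => ((Kernel.prodMkRight E κ₀) ⊗ₖ (Kernel.prodMkLeft (Ω × E) κF)).comap
            (fun h : (i : ↥(Finset.Iic n)) → Ω × E => h ⟨n, Finset.mem_Iic.2 le_rfl⟩)
            (measurable_pi_apply _)))]
    (μ₀' : Measure (Ω × E')) [IsProbabilityMeasure μ₀'] {a' b' : ℕ → ℕ}
    (ha' : Tendsto a' atTop atTop) (hb' : Tendsto b' atTop atTop)
    [IsProbabilityMeasure (Kernel.trajMeasure (X := fun _ : ℕ => Ω × E') μ₀'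
          (fun n : ℕ => ((Kernel.prodMkRight E' κ₀') ⊗ₖ (Kernel.prodMkLeft (Ω × E') κF')).comap
            (fun h : (i : ↥(Finset.Iic n)) → Ω × E' => h ⟨n, Finset.mem_Iic.2 le_rfl⟩)
            (measurable_pi_apply _)))]
    {m : ℕ → ℕ} (hm : Tendsto m atTop atTop)
    {Ω' : Type*} [MeasurableSpace Ω'] {P' : Measure Ω'} [IsProbabilityMeasure P'] {Z : Ω' → ℝ}
    (hZ : HasLaw Z (gaussianReal 0 1) P') :
    TendstoInDistribution (fun (n : ℕ) (ω : (ℕ → Ω × E) × (ℕ → Ω × E')) =>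
        ((∑ t ∈ Finset.range n, Real.exp (-W (ω.1 t).2)) / n
            - (∑ t ∈ Finset.range (m n), Real.exp (-W' (ω.2 t).2)) / (m n))
          / Real.sqrt ((((b n * a n : ℕ) : ℝ) * replicaSEsq (fun j (x : ℕ → Ω × E) =>
              (∑ i ∈ Finset.range (b n), Real.exp (-W (x (b n * j + i)).2)) / (b n)) (a n) ω.1) / n
            + (((b' (m n) * a' (m n) : ℕ) : ℝ) * replicaSEsq (fun j (x : ℕ → Ω × E') =>
              (∑ i ∈ Finset.range (b' (m n)), Real.exp (-W' (x (b' (m n) * j + i)).2))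
              / (b' (m n))) (a' (m n)) ω.2) / (m n)))
      atTop Z (fun _ => ((Kernel.trajMeasure (X := fun _ : ℕ => Ω × E) μ₀
          (fun n : ℕ => ((Kernel.prodMkRight E κ₀) ⊗ₖ (Kernel.prodMkLeft (Ω × E) κF)).comap
            (fun h : (i : ↥(Finset.Iic n)) → Ω × E => h ⟨n, Finset.mem_Iic.2 le_rfl⟩)
            (measurable_pi_apply _)))).prod
        (Kernel.trajMeasure (X := fun _ : ℕ => Ω × E') μ₀'
          (fun n : ℕ => ((Kernel.prodMkRight E' κ₀') ⊗ₖ (Kernel.prodMkLeft (Ω × E') κF')).comap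
            (fun h : (i : ↥(Finset.Iic n)) → Ω × E' => h ⟨n, Finset.mem_Iic.2 le_rfl⟩)
            (measurable_pi_apply _)))) P' := by
  -- each restart chain is minorised in ONE step by its invariant law
  have hmin1 : ∀ z, ε • (π₀ ⊗ₘ κF)
      ≤ nHit ((Kernel.prodMkRight E κ₀) ⊗ₖ (Kernel.prodMkLeft (Ω × E) κF)) 1 z := fun z => by
    rw [nHit_one]
    refine Measure.le_iff.2 fun B hB => ?_
    rw [Measure.smul_apply, smul_eq_mul]
    exact restart_doeblin (κF := κF) hmin z hB
  have hmin1' : ∀ z, ε' • (π₀ ⊗ₘ κF')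
      ≤ nHit ((Kernel.prodMkRight E' κ₀') ⊗ₖ (Kernel.prodMkLeft (Ω × E') κF')) 1 z := fun z => by
    rw [nHit_one]
    refine Measure.le_iff.2 fun B hB => ?_
    rw [Measure.smul_apply, smul_eq_mul]
    exact restart_doeblin (κF := κF') hmin' z hB
  haveI : Nonempty (Ω × E) := nonempty_of_isProbabilityMeasure μ₀
  haveI : Nonempty (Ω × E') := nonempty_of_isProbabilityMeasure μ₀'
  have hε1 : ε ≤ 1 := by
    haveI := isMarkovKernel_nHit ((Kernel.prodMkRight E κ₀) ⊗ₖ (Kernel.prodMkLeft (Ω × E) κF)) 1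
    exact eps_le_one_of_minorised hmin1
  have hε1' : ε' ≤ 1 := by
    haveI := isMarkovKernel_nHit
      ((Kernel.prodMkRight E' κ₀') ⊗ₖ (Kernel.prodMkLeft (Ω × E') κF')) 1
    exact eps_le_one_of_minorised hmin1'
  -- the two weights: bounded, measurable, with THE SAME mean `Z₁/Z₀`
  have hf : Measurable fun p : Ω × E => Real.exp (-W p.2) :=
    Real.measurable_exp.comp (h.measurable_W.comp measurable_snd).neg
  have hf' : Measurable fun p : Ω × E' => Real.exp (-W' p.2) :=
    Real.measurable_exp.comp (h'.measurable_W.comp measurable_snd).neg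
  have hC : ∀ p : Ω × E, |Real.exp (-W p.2)| ≤ Real.exp (-Wlo) := fun p => by
    rw [abs_of_pos (Real.exp_pos _)]; exact Real.exp_le_exp.2 (neg_le_neg (hlo p.2))
  have hC' : ∀ p : Ω × E', |Real.exp (-W' p.2)| ≤ Real.exp (-Wlo') := fun p => by
    rw [abs_of_pos (Real.exp_pos _)]; exact Real.exp_le_exp.2 (neg_le_neg (hlo' p.2))
  have hmean : ∫ p, Real.exp (-W p.2) ∂(π₀ ⊗ₘ κF) = ∫ p, Real.exp (-W' p.2) ∂(π₀ ⊗ₘ κF') := by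
    rw [restart_jarzynski_mean h hπ₀, restart_jarzynski_mean h' hπ₀]
  exact doeblinPower_twoChain_agreement_clt (invariant_restart hinv) hmin1 hε0 hε1 one_pos hf hC hσ
    μ₀ ha hb (invariant_restart hinv') hmin1' hε0' hε1' one_pos hf' hC' hσ' μ₀' ha' hb' hmean hm hZ

omit [IsFiniteMeasure ν₀] [IsFiniteMeasure ν₁] in
/-- **THE TWO-PROTOCOL AGREEMENT TEST IS CALIBRATED.**  Under the hypotheses of
`restart_jarzynski_twoProtocol_agreement_clt`, for every `z > 0`:
`(P_{μ₀} ⊗ P'_{μ₀'}) {|Ḡ_A,n − Ḡ'_B,m_n| / √(σ̂²_A,n/n + σ̂²_B,m_n/m_n) ≤ z} → (gaussianReal 0 1)[−z, z]`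
(`≈ 0.95` at `z = 1.96`, `≈ 0.683` at `z = 1`). -/
theorem restart_jarzynski_twoProtocol_agreement_coverage
    (h : CrooksPair ν₀ ν₁ κF κR s e W) (h' : CrooksPair ν₀ ν₁ κF' κR' s' e' W')
    (hπ₀ : π₀ = (ν₀ univ)⁻¹ • ν₀)
    (hinv : Kernel.Invariant κ₀ π₀) (hinv' : Kernel.Invariant κ₀' π₀)
    (hmin : ∀ x {B : Set Ω}, MeasurableSet B → ε * π₀ B ≤ κ₀ x B) (hε0 : 0 < ε)
    (hmin' : ∀ x {B : Set Ω}, MeasurableSet B → ε' * π₀ B ≤ κ₀' x B) (hε0' : 0 < ε')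
    {Wlo : ℝ} (hlo : ∀ ω, Wlo ≤ W ω) {Wlo' : ℝ} (hlo' : ∀ ω, Wlo' ≤ W' ω)
    (hσ : 0 < ((∫ p, (Real.exp (-W p.2) - ∫ p', Real.exp (-W p'.2) ∂(π₀ ⊗ₘ κF)) ^ 2 ∂(π₀ ⊗ₘ κF))
          + 2 * ∑' k, ∫ p, (Real.exp (-W p.2) - ∫ p', Real.exp (-W p'.2) ∂(π₀ ⊗ₘ κF))
            * (kop ((Kernel.prodMkRight E κ₀) ⊗ₖ (Kernel.prodMkLeft (Ω × E) κF)))^[k + 1]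
              (fun p => Real.exp (-W p.2) - ∫ p', Real.exp (-W p'.2) ∂(π₀ ⊗ₘ κF)) p ∂(π₀ ⊗ₘ κF)))
    (hσ' : 0 < ((∫ p, (Real.exp (-W' p.2) - ∫ p', Real.exp (-W' p'.2) ∂(π₀ ⊗ₘ κF')) ^ 2
            ∂(π₀ ⊗ₘ κF'))
          + 2 * ∑' k, ∫ p, (Real.exp (-W' p.2) - ∫ p', Real.exp (-W' p'.2) ∂(π₀ ⊗ₘ κF'))
            * (kop ((Kernel.prodMkRight E' κ₀') ⊗ₖ (Kernel.prodMkLeft (Ω × E') κF')))^[k + 1]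
              (fun p => Real.exp (-W' p.2) - ∫ p', Real.exp (-W' p'.2) ∂(π₀ ⊗ₘ κF')) p
              ∂(π₀ ⊗ₘ κF')))
    (μ₀ : Measure (Ω × E)) [IsProbabilityMeasure μ₀] {a b : ℕ → ℕ} (ha : Tendsto a atTop atTop)
    (hb : Tendsto b atTop atTop)
    [IsProbabilityMeasure (Kernel.trajMeasure (X := fun _ : ℕ => Ω × E) μ₀
          (fun n : ℕ => ((Kernel.prodMkRight E κ₀) ⊗ₖ (Kernel.prodMkLeft (Ω × E) κF)).comap
            (fun h : (i : ↥(Finset.Iic n)) → Ω × E => h ⟨n, Finset.mem_Iic.2 le_rfl⟩)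
            (measurable_pi_apply _)))]
    (μ₀' : Measure (Ω × E')) [IsProbabilityMeasure μ₀'] {a' b' : ℕ → ℕ}
    (ha' : Tendsto a' atTop atTop) (hb' : Tendsto b' atTop atTop)
    [IsProbabilityMeasure (Kernel.trajMeasure (X := fun _ : ℕ => Ω × E') μ₀'
          (fun n : ℕ => ((Kernel.prodMkRight E' κ₀') ⊗ₖ (Kernel.prodMkLeft (Ω × E') κF')).comap
            (fun h : (i : ↥(Finset.Iic n)) → Ω × E' => h ⟨n, Finset.mem_Iic.2 le_rfl⟩)
            (measurable_pi_apply _)))]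
    {m : ℕ → ℕ} (hm : Tendsto m atTop atTop) {z : ℝ} (hz : 0 < z) :
    Tendsto (fun n : ℕ => (((Kernel.trajMeasure (X := fun _ : ℕ => Ω × E) μ₀
          (fun n : ℕ => ((Kernel.prodMkRight E κ₀) ⊗ₖ (Kernel.prodMkLeft (Ω × E) κF)).comap
            (fun h : (i : ↥(Finset.Iic n)) → Ω × E => h ⟨n, Finset.mem_Iic.2 le_rfl⟩)
            (measurable_pi_apply _)))).prod
        (Kernel.trajMeasure (X := fun _ : ℕ => Ω × E') μ₀'
          (fun n : ℕ => ((Kernel.prodMkRight E' κ₀') ⊗ₖ (Kernel.prodMkLeft (Ω × E') κF')).comap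
            (fun h : (i : ↥(Finset.Iic n)) → Ω × E' => h ⟨n, Finset.mem_Iic.2 le_rfl⟩)
            (measurable_pi_apply _)))).real
      {ω | |((∑ t ∈ Finset.range n, Real.exp (-W (ω.1 t).2)) / n
            - (∑ t ∈ Finset.range (m n), Real.exp (-W' (ω.2 t).2)) / (m n))
          / Real.sqrt ((((b n * a n : ℕ) : ℝ) * replicaSEsq (fun j (x : ℕ → Ω × E) =>
              (∑ i ∈ Finset.range (b n), Real.exp (-W (x (b n * j + i)).2)) / (b n)) (a n) ω.1) / n
            + (((b' (m n) * a' (m n) : ℕ) : ℝ) * replicaSEsq (fun j (x : ℕ → Ω × E') =>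
              (∑ i ∈ Finset.range (b' (m n)), Real.exp (-W' (x (b' (m n) * j + i)).2))
              / (b' (m n))) (a' (m n)) ω.2) / (m n))| ≤ z})
      atTop (𝓝 ((gaussianReal 0 1).real (Set.Icc (-z) z))) := by
  have hmin1 : ∀ z, ε • (π₀ ⊗ₘ κF)
      ≤ nHit ((Kernel.prodMkRight E κ₀) ⊗ₖ (Kernel.prodMkLeft (Ω × E) κF)) 1 z := fun z => by
    rw [nHit_one]
    refine Measure.le_iff.2 fun B hB => ?_
    rw [Measure.smul_apply, smul_eq_mul]
    exact restart_doeblin (κF := κF) hmin z hB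
  have hmin1' : ∀ z, ε' • (π₀ ⊗ₘ κF')
      ≤ nHit ((Kernel.prodMkRight E' κ₀') ⊗ₖ (Kernel.prodMkLeft (Ω × E') κF')) 1 z := fun z => by
    rw [nHit_one]
    refine Measure.le_iff.2 fun B hB => ?_
    rw [Measure.smul_apply, smul_eq_mul]
    exact restart_doeblin (κF := κF') hmin' z hB
  haveI : Nonempty (Ω × E) := nonempty_of_isProbabilityMeasure μ₀
  haveI : Nonempty (Ω × E') := nonempty_of_isProbabilityMeasure μ₀'
  have hε1 : ε ≤ 1 := by
    haveI := isMarkovKernel_nHit ((Kernel.prodMkRight E κ₀) ⊗ₖ (Kernel.prodMkLeft (Ω × E) κF)) 1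
    exact eps_le_one_of_minorised hmin1
  have hε1' : ε' ≤ 1 := by
    haveI := isMarkovKernel_nHit
      ((Kernel.prodMkRight E' κ₀') ⊗ₖ (Kernel.prodMkLeft (Ω × E') κF')) 1
    exact eps_le_one_of_minorised hmin1'
  have hf : Measurable fun p : Ω × E => Real.exp (-W p.2) :=
    Real.measurable_exp.comp (h.measurable_W.comp measurable_snd).neg
  have hf' : Measurable fun p : Ω × E' => Real.exp (-W' p.2) :=
    Real.measurable_exp.comp (h'.measurable_W.comp measurable_snd).neg
  have hC : ∀ p : Ω × E, |Real.exp (-W p.2)| ≤ Real.exp (-Wlo) := fun p => by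
    rw [abs_of_pos (Real.exp_pos _)]; exact Real.exp_le_exp.2 (neg_le_neg (hlo p.2))
  have hC' : ∀ p : Ω × E', |Real.exp (-W' p.2)| ≤ Real.exp (-Wlo') := fun p => by
    rw [abs_of_pos (Real.exp_pos _)]; exact Real.exp_le_exp.2 (neg_le_neg (hlo' p.2))
  have hmean : ∫ p, Real.exp (-W p.2) ∂(π₀ ⊗ₘ κF) = ∫ p, Real.exp (-W' p.2) ∂(π₀ ⊗ₘ κF') := by
    rw [restart_jarzynski_mean h hπ₀, restart_jarzynski_mean h' hπ₀]
  exact doeblinPower_twoChain_agreement_coverage (invariant_restart hinv) hmin1 hε0 hε1 one_pos hf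
    hC hσ μ₀ ha hb (invariant_restart hinv') hmin1' hε0' hε1' one_pos hf' hC' hσ' μ₀' ha' hb' hmean
    hm hz

end TwoProtocols

end Summit.Ventures.LatticeQCDFlow.Scoring

end
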